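import Summits.ValiantsHypothesis.ValiantsHypothesis.Theorems.RigidityForcesSymmetryRankRigidMinimalReprLaplaceResidualFibreSum
import Summits.ValiantsHypothesis.ValiantsHypothesis.Theorems.RigidityForcesSymmetryRankRigidMinimalReprLaplaceResidualIndicatorKernel

/-!
# CASE 2 of the `a = 3` residual blueprint for `LaplaceOptimal 5`, in the two-slot (fibre-sum) currency
# (crux `RankRigidMinimalRepr`, stmt-ValiantsHypothesis-18034; frontier rung `LaplaceOptimalFive`, stmt-24813)

Bridge between the fibre sums `F(x,y) = Σ_{σ 3 = x, σ 4 = y} φ₀(σ0)φ₁(σ1)φ₂(σ2)` of the two-slot expansion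
(`LaplaceResidual.permanent_two_slot`, p614067; `fibreSum_eq_permanent_three`, `fibreSum_relabel`, val-port-2 p615706) and
the `3 × 3`-permanent hypotheses of the kernel lemmas (`…LaplaceResidualIndicatorKernel`, this seat):

* `exists_perm_apply_zero_one_two_fin5` — a permutation of `Fin 5` with prescribed distinct values at `0, 1, 2`;
* **`triplePerm_eq_zero_of_fibreSum_eq_zero`** — GENERAL bridge: if `F(x,y) = 0` for all `x ≠ y`, then EVERY `3 × 3`
  permanent `φ₀ a (φ₁ b φ₂ c + φ₁ c φ₂ b) + φ₀ b (…) + φ₀ c (…)` on distinct letters vanishes (relabel so that the triple is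
  `{0,1,2}`, i.e. the complement of `(3,4)`);
* the CASE-2 kernel lines in this currency, for `φ₀` with `φ₀(a) = 0` and full support off `a`:
  `fibreSum_kernel_line_of_apply_ne_zero` (K1: `φ₁(a) ≠ 0` ⇒ `φ₂ = κ·ψ̄`), `fibreSum_kernel_line_of_two_letters` (K2a),
  `fibreSum_kernel_zero_of_balanced` (K2b: `φ₂ = 0`) — the inputs «dim ker(φ₂ ↦ F) ≤ 1» of the image-dimension reduction
  (val-port-2's memo `NOTE-port2-24813-a3-residual-bricks.md` (R1)), Case 2.
Slot-indexed covectors `φ : Fin 5 → Fin 5 → ℂ` as in the landed files; no definitions.  Seat val-lit-p3 g14 (second hand under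
val-port-2's cut, val-lit desk RULING #260 (c)).

HONEST FRAMING: elementary helper lemmas toward the frontier rung `LaplaceOptimalFive` (stmt-24813), which stays OPEN (as do
24814 / 18034); `hres` is NOT discharged here; nothing bears on `VP ≠ VNP`, which is NOT proved. [folklore]
-/

set_option autoImplicit false

-- the mandated summit-side namespace repeats a component by design (single-problem summit)
set_option linter.dupNamespace false

namespace Summit.ValiantsHypothesis.ValiantsHypothesis.Theorems.RigidityForcesSymmetryRankRigidMinimalRepr

namespace LaplaceResidual

open Finset

/-! ### §1 Relabelling three letters -/

/-- For pairwise distinct letters `a, b, c` of `Fin 5` there is a permutation `σ` with `σ 0 = a`, `σ 1 = b`, `σ 2 = c`. [folklore] -/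
theorem exists_perm_apply_zero_one_two_fin5 (a b c : Fin 5) (hab : a ≠ b) (hac : a ≠ c) (hbc : b ≠ c) :
    ∃ σ : Equiv.Perm (Fin 5), σ 0 = a ∧ σ 1 = b ∧ σ 2 = c := by
  classical
  obtain ⟨σ, h0, h1⟩ := exists_perm_apply_zero_one a b hab
  set c' : Fin 5 := σ.symm c with hc'
  have hc'0 : c' ≠ 0 := by
    intro h
    apply hac
    rw [← h0, ← h, hc', Equiv.apply_symm_apply]
  have hc'1 : c' ≠ 1 := by
    intro h
    apply hbc
    rw [← h1, ← h, hc', Equiv.apply_symm_apply]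
  refine ⟨(Equiv.swap (2 : Fin 5) c').trans σ, ?_, ?_, ?_⟩
  · rw [Equiv.trans_apply, Equiv.swap_apply_of_ne_of_ne (by decide) hc'0.symm, h0]
  · rw [Equiv.trans_apply, Equiv.swap_apply_of_ne_of_ne (by decide) hc'1.symm, h1]
  · rw [Equiv.trans_apply, Equiv.swap_apply_left, hc', Equiv.apply_symm_apply]

/-! ### §2 Vanishing fibre sums ⇒ vanishing `3 × 3` permanents -/

/-- **Bridge.**  If every fibre sum `F(x,y)`, `x ≠ y`, of the two-slot expansion vanishes, then every `3 × 3` permanent of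
`(φ₀; φ₁; φ₂)` on three distinct letters vanishes. [folklore] -/
theorem triplePerm_eq_zero_of_fibreSum_eq_zero (φ : Fin 5 → Fin 5 → ℂ)
    (hF : ∀ x y : Fin 5, x ≠ y →
      (∑ τ : Equiv.Perm (Fin 5), if τ 3 = x ∧ τ 4 = y then φ 0 (τ 0) * φ 1 (τ 1) * φ 2 (τ 2) else 0) = 0) :
    ∀ a b c : Fin 5, a ≠ b → a ≠ c → b ≠ c →
      φ 0 a * (φ 1 b * φ 2 c + φ 1 c * φ 2 b) + φ 0 b * (φ 1 a * φ 2 c + φ 1 c * φ 2 a) +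
        φ 0 c * (φ 1 a * φ 2 b + φ 1 b * φ 2 a) = 0 := by
  intro a b c hab hac hbc
  obtain ⟨σ, h0, h1, h2⟩ := exists_perm_apply_zero_one_two_fin5 a b c hab hac hbc
  -- the fibre sum of the relabelled covectors at `(3,4)` is the permanent on the letters `σ 0, σ 1, σ 2`
  have key := fibreSum_eq_permanent_three (fun s => φ s ∘ σ) 3 3
  simp only [Function.comp_apply] at key
  rw [fibreSum_relabel φ σ 3 ((3 : Fin 5).succAbove 3),
    hF (σ 3) (σ ((3 : Fin 5).succAbove 3)) (σ.injective.ne (by decide))] at key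
  simp only [show ((3 : Fin 5).succAbove ((3 : Fin 4).succAbove 0)) = 0 by decide,
    show ((3 : Fin 5).succAbove ((3 : Fin 4).succAbove 1)) = 1 by decide,
    show ((3 : Fin 5).succAbove ((3 : Fin 4).succAbove 2)) = 2 by decide, h0, h1, h2] at key
  linear_combination -key

/-! ### §3 The Case-2 kernel lines in the fibre-sum currency -/

/-- **(K1), fibre-sum form.**  `φ₀(a) = 0`, `φ₀(c) ≠ 0` off `a`, `φ₁(a) ≠ 0`: if all fibre sums `F(x,y)`, `x ≠ y`, vanish,
then `φ₂ = κ·ψ̄` with `ψ̄ = (−φ₁(a)) e_a + Σ_{x≠a} φ₁(x) e_x`. [folklore] -/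
theorem fibreSum_kernel_line_of_apply_ne_zero (φ : Fin 5 → Fin 5 → ℂ) (a : Fin 5) (ha : φ 0 a = 0)
    (h0 : ∀ c, c ≠ a → φ 0 c ≠ 0) (h1 : φ 1 a ≠ 0)
    (hF : ∀ x y : Fin 5, x ≠ y →
      (∑ τ : Equiv.Perm (Fin 5), if τ 3 = x ∧ τ 4 = y then φ 0 (τ 0) * φ 1 (τ 1) * φ 2 (τ 2) else 0) = 0) :
    ∃ κ : ℂ, ∀ x, φ 2 x = κ * (if x = a then -φ 1 a else φ 1 x) :=
  kernel_line_of_apply_ne_zero (φ 0) (φ 1) a ha h0 h1 (φ 2) (triplePerm_eq_zero_of_fibreSum_eq_zero φ hF)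

/-- **(K2a), fibre-sum form.**  `φ₀(a) = 0`, full support off `a`; `φ₁(a) = 0`, `φ₁ ⊆ {b,c}` with
`φ₀(c)φ₁(b) + φ₀(b)φ₁(c) ≠ 0`: if all fibre sums vanish, then `φ₂ = κ·(φ₁(b) e_b − φ₁(c) e_c)`. [folklore] -/
theorem fibreSum_kernel_line_of_two_letters (φ : Fin 5 → Fin 5 → ℂ) (a : Fin 5) (ha : φ 0 a = 0)
    (h0 : ∀ c, c ≠ a → φ 0 c ≠ 0) (b c : Fin 5) (hba : b ≠ a) (hca : c ≠ a) (hbc : b ≠ c)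
    (h1a : φ 1 a = 0) (h1off : ∀ x, x ≠ b → x ≠ c → φ 1 x = 0) (hnd : φ 0 c * φ 1 b + φ 0 b * φ 1 c ≠ 0)
    (hF : ∀ x y : Fin 5, x ≠ y →
      (∑ τ : Equiv.Perm (Fin 5), if τ 3 = x ∧ τ 4 = y then φ 0 (τ 0) * φ 1 (τ 1) * φ 2 (τ 2) else 0) = 0) :
    ∃ κ : ℂ, ∀ x, φ 2 x = κ * (if x = b then φ 1 b else if x = c then -φ 1 c else 0) :=
  kernel_line_of_two_letters (φ 0) (φ 1) a ha h0 b c hba hca hbc h1a h1off hnd (φ 2)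
    (triplePerm_eq_zero_of_fibreSum_eq_zero φ hF)

/-- **(K2b), fibre-sum form.**  `φ₀(a) = 0`, full support off `a`; `b, c, d, e` the other letters; `φ₁(a) = 0` and
`φ₁ = (φ₀(b), φ₀(c), −φ₀(d), −φ₀(e))` there: if all fibre sums vanish, then `φ₂ = 0`. [folklore] -/
theorem fibreSum_kernel_zero_of_balanced (φ : Fin 5 → Fin 5 → ℂ) (a b c d e : Fin 5) (ha : φ 0 a = 0)
    (h0 : ∀ x, x ≠ a → φ 0 x ≠ 0)
    (hba : b ≠ a) (hca : c ≠ a) (hda : d ≠ a) (hea : e ≠ a)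
    (hbc : b ≠ c) (hbd : b ≠ d) (hbe : b ≠ e) (hcd : c ≠ d) (hce : c ≠ e) (hde : d ≠ e)
    (h1a : φ 1 a = 0) (h1b : φ 1 b = φ 0 b) (h1c : φ 1 c = φ 0 c) (h1d : φ 1 d = -φ 0 d) (h1e : φ 1 e = -φ 0 e)
    (hF : ∀ x y : Fin 5, x ≠ y →
      (∑ τ : Equiv.Perm (Fin 5), if τ 3 = x ∧ τ 4 = y then φ 0 (τ 0) * φ 1 (τ 1) * φ 2 (τ 2) else 0) = 0) :
    ∀ x, φ 2 x = 0 :=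
  kernel_of_balanced (φ 0) (φ 1) (φ 2) a b c d e ha h0 hba hca hda hea hbc hbd hbe hcd hce hde
    (triplePerm_eq_zero_of_fibreSum_eq_zero φ hF) h1a h1b h1c h1d h1e

/-- (K2b) in the «kernel ⊆ a line» shape (any `w`; here with `w = 0`), for a uniform interface. [folklore] -/
theorem fibreSum_kernel_line_of_balanced (φ : Fin 5 → Fin 5 → ℂ) (a b c d e : Fin 5) (ha : φ 0 a = 0)
    (h0 : ∀ x, x ≠ a → φ 0 x ≠ 0)
    (hba : b ≠ a) (hca : c ≠ a) (hda : d ≠ a) (hea : e ≠ a)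
    (hbc : b ≠ c) (hbd : b ≠ d) (hbe : b ≠ e) (hcd : c ≠ d) (hce : c ≠ e) (hde : d ≠ e)
    (h1a : φ 1 a = 0) (h1b : φ 1 b = φ 0 b) (h1c : φ 1 c = φ 0 c) (h1d : φ 1 d = -φ 0 d) (h1e : φ 1 e = -φ 0 e)
    (hF : ∀ x y : Fin 5, x ≠ y →
      (∑ τ : Equiv.Perm (Fin 5), if τ 3 = x ∧ τ 4 = y then φ 0 (τ 0) * φ 1 (τ 1) * φ 2 (τ 2) else 0) = 0) :
    ∃ κ : ℂ, ∀ x, φ 2 x = κ * (0 : Fin 5 → ℂ) x :=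
  ⟨0, fun x => by
    rw [fibreSum_kernel_zero_of_balanced φ a b c d e ha h0 hba hca hda hea hbc hbd hbe hcd hce hde h1a h1b h1c h1d h1e
      hF x]
    simp⟩

end LaplaceResidual

end Summit.ValiantsHypothesis.ValiantsHypothesis.Theorems.RigidityForcesSymmetryRankRigidMinimalRepr
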